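import Summits.QuantumFields.YangMills.Theorems.UnitScaleTiltProp7TrueLinIterDefect
import HarnessLib

/-!
# Route `UnitScaleTilt`, crux K1 «MinimiserStabilityRegPr» (stmt-QuantumFields-19200), EX face — K-storey (px12 g16 LOCATE-K137, pen (K1b-a) «transported interpolant», px13 g15) and the
# one-form VALUE book: THE ROW (`ℓ^∞ → ℓ^∞`) TWIN OF DEFECT ∕ (COL) — THE REDUCED TRUE-LINEARISED ITERATE IN SUP NORM:
# `‖G_k‖_∞ ≤ L^k·exp((κ_∞∕L)·Σ_{j<k} a_j)·‖Y‖_∞` and `L·‖G_k − S_k‖_∞ ≤ L^k·κ_∞·(Σ_{j<k}a_j)·exp((κ_∞∕L)Σ_{j<k}a_j)·‖Y‖_∞`, `κ_∞ = 159(d+2)L·(2dL^d)`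

Cell `ym3-torus` (HUMAN RULING D-0037; rung R3 = SU(2) YM₃ on T³ — NOT d = 4, NOT infinite volume, NOT a mass gap, NOT Clay).  Width seat `ym3-torus-px13` (gen 15; frames ∕
intertwiner lineage); pen (K1b-a) of px12 g16's K-storey («GO» 2026-08-30 08:53Z): a SUP-norm currency for the averaging operator of record, next to the `ℓ²` rows (R1)∕(R2) and the
`ℓ¹`-column rows (COL) — the natural letters for POINTWISE ∕ kernel consumers (K-storey (K3)∕(K4)); row (a) of (K1b-a) itself is read in `ℓ²` via (L5c).  THEOREMS ONLY (0 `def`, 0 `sorry`); `--supports stmt-QuantumFields-19200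
--as helper`; count-neutral.  Sibling of ✓`Prop7TrueLinIterColumn` (the `ℓ¹` twin, (COL) brick 1).

THE POINT.  The same re-summation as the column twin, read along ROWS: ✓`Prop7TrueLinLineBound.norm_line_le` bounds `‖LINE_VZ(c)‖` by the weight-`L^{−d}` mass of the `L^{d+1}`
line bonds of `c`, so `‖LINE_VZ(c)‖ ≤ L·‖Z‖_∞`; ✓`Prop7TrueLinDefectBound.norm_defect_le_nbhd` bounds the one-step defect by `159·a·(d+2)L·Σ_{b∈N(c)}‖Z(b)‖` over the two-block
neighbourhood with `#N(c) ≤ 2dL^d` (✓`card_nbhd_le`), so `‖D(c)‖ ≤ 159·a·(d+2)L·2dL^d·‖Z‖_∞`; hence per level `‖G_{j+1}‖_∞ ≤ (L + κ_∞a_j)‖G_j‖_∞` and ✓`recursion_bound` (`ρ := L`).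
At the d = 3 carrier: `η·‖G_{K−n}‖_∞ ≤ e^{κ_∞B∕L}‖Y‖_∞` (`ηℓ = 1`) and `η·‖G_{K−n} − S_{K−n}‖_∞ ≤ (κ_∞B∕L)e^{κ_∞B∕L}‖Y‖_∞ = O(L⁶ε₀)‖Y‖_∞` — the averaging operator of record is an
`ℓ^∞`-contraction up to `e^{O(L⁶ε₀)}` and is sup-close to the pure LINE iterate on bounded fields (sequel files: stair-gauge ∕ `RegPr` ∕ `QTwS` editions).

WHAT IS PROVED (ns `…Theorems.Prop7TrueLinIterRow`; letters VERBATIM as DEFECT).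
* §1 `norm_line_le_of_sup` — `(∀ b, ‖Z b‖ ≤ M) → ‖LINE_VZ(c)‖ ≤ L·M`; `norm_defect_le_of_sup` — `(∀ b, ‖Z b‖ ≤ M) → ‖D(c)‖ ≤ 159·α·(d+2)L·(2dL^d)·M` (`0 ≤ α ≤ 1∕24`, `α < δ_N`, `0 ≤ M`).
* §2 ★★ `norm_reduced_sub_lineIter_le_of_sup` — DEFECT's hypotheses VERBATIM + `hM : ∀ b, ‖Y b‖ ≤ M`; conclusion: `∀ c, L·‖G k c − S k c‖ ≤ L^k·κ_∞·(Σ_{j<k}a j)·exp((κ_∞∕L)Σ_{j<k}a j)·M`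
  and `∀ c, ‖G k c‖ ≤ L^k·exp((κ_∞∕L)Σ_{j<k}a j)·M`.
HONEST SCOPE.  Sup-norm bookkeeping over landed one-step letters; nothing of (K1b), the K137 rows, EX or the crux is proved here.

References: T. Bałaban, CMP **95** (1984) 17–40 [Balaban1984PropagatorsI] ((1.11), (1.18)–(1.20) pp.19–20); CMP **98** (1985) 17–51 [Balaban1985Averaging] (Prop. 3 (124)–(126) p.36).
-/

set_option autoImplicit false

noncomputable section

open scoped BigOperators Matrix.Norms.L2Operator

namespace Summit.QuantumFields.YangMills.Theorems.Prop7TrueLinIterRow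

open Literature.MathematicalPhysics.QuantumFieldTheory.Balaban1983to89
open Finset T4Continuum BlockAveraging AveragingRT ExpMeanLog BlockAveragingEMLLinearised BlockAveragingEMLLinearisedBackground BlockAveragingEMLProp2
open Summit.QuantumFields.YangMills.Theorems.Prop7TrueLinLineBound (line_sub norm_line_le)
open Summit.QuantumFields.YangMills.Theorems.Prop7TrueLinDefectBound (norm_defect_le_nbhd card_nbhd_le)
open Summit.QuantumFields.YangMills.Theorems.Prop7TrueLinIterDefect (recursion_bound)

variable {P : Params} {n : Type*} [Fintype n] [DecidableEq n] [Nonempty n] {j : ℕ}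

/-! ## §1 The one-step sup-norm rows -/

/-- **`‖LINE_VZ(c)‖ ≤ L·‖Z‖_∞`**: the pointwise weighted-`ℓ¹` bound ✓`norm_line_le` with every one of the `L^d·L` line terms bounded by the sup. [cite: Balaban1984PropagatorsI, (1.11), (1.18) pp.19-20] -/
theorem norm_line_le_of_sup (V : GaugeField P j (Matrix.specialUnitaryGroup n ℂ)) (Z : PBond P j → Matrix n n ℂ) {M : ℝ} (hM : ∀ b, ‖Z b‖ ≤ M)
    (c : PBond P (j + 1)) :
    ‖((Fintype.card (Idx P) : ℂ))⁻¹ • ∑ i : Idx P,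
        ((holAt V (walk (emb c.src) (stairWord i.2.1 (off i.1))) : Matrix.specialUnitaryGroup n ℂ) : Matrix n n ℂ) *
          covWalkSum V Z (walk (walkEnd (emb c.src) (stairWord i.2.1 (off i.1))) (List.replicate P.L (c.dir, true))) *
        star ((holAt V (walk (emb c.src) (stairWord i.2.1 (off i.1))) : Matrix.specialUnitaryGroup n ℂ) : Matrix n n ℂ)‖
      ≤ (P.L : ℝ) * M := by
  have hLpos : (0 : ℝ) < (P.L : ℝ) := by exact_mod_cast P.L_pos
  refine (norm_line_le V Z c).trans ?_
  calc ((P.L : ℝ) ^ P.d)⁻¹ * ∑ r : Fin P.d → Fin P.L, ∑ t ∈ Finset.range P.L, ‖Z ⟨(fun z : Site P j => z.shift c.dir)^[t] (Site.blockSite c.src r), c.dir⟩‖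
      ≤ ((P.L : ℝ) ^ P.d)⁻¹ * ∑ r : Fin P.d → Fin P.L, ∑ t ∈ Finset.range P.L, M := by
        gcongr with r _ t _
        exact hM _
    _ = (P.L : ℝ) * M := by
        simp only [Finset.sum_const, Finset.card_range, Finset.card_univ, Fintype.card_fun, Fintype.card_fin, nsmul_eq_mul]
        push_cast
        field_simp

/-- **THE SUP-NORM DEFECT ROW OF ONE STEP**: `‖T(V)Z(c) − P_{V̄}(CM_VZ)(c) − LINE_VZ(c)‖ ≤ 159·α·(d+2)L·(2dL^d)·‖Z‖_∞` — ✓`norm_defect_le_nbhd` with the neighbourhood sum bounded by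
`#N(c)·‖Z‖_∞`, `#N(c) ≤ 2dL^d` (✓`card_nbhd_le`). [cite: Balaban1985Averaging, Prop. 3 (124)-(126) p.36] -/
theorem norm_defect_le_of_sup (hj : j + 1 ≤ P.m + P.K) (V : GaugeField P j (Matrix.specialUnitaryGroup n ℂ)) (Z : PBond P j → Matrix n n ℂ)
    {M : ℝ} (hM0 : 0 ≤ M) (hM : ∀ b, ‖Z b‖ ≤ M)
    (c : PBond P (j + 1)) {α : ℝ} (hα0 : 0 ≤ α) (hα : ∀ i : Idx P, dist1 (loopHol V c i) ≤ α) (hα24 : α ≤ 1 / 24) (hN : α < deltaSU n) :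
    ‖(fderiv ℂ (eml : (Idx P → Matrix n n ℂ) → Matrix n n ℂ) (fun i => ((loopHol V c i : Matrix.specialUnitaryGroup n ℂ) : Matrix n n ℂ))
          (fun i => covWalkSum V Z (walk (emb c.src) (loopWord P.L c.dir (off i.1) i.2.1 i.2.2))
            * ((loopHol V c i : Matrix.specialUnitaryGroup n ℂ) : Matrix n n ℂ))
          * star ((corr (expMeanLogSU (n := n)) V c : Matrix.specialUnitaryGroup n ℂ) : Matrix n n ℂ)
        + ((corr (expMeanLogSU (n := n)) V c : Matrix.specialUnitaryGroup n ℂ) : Matrix n n ℂ)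
          * covWalkSum V Z (walk (emb c.src) (List.replicate P.L (c.dir, true)))
          * star ((corr (expMeanLogSU (n := n)) V c : Matrix.specialUnitaryGroup n ℂ) : Matrix n n ℂ))
      - ((((Fintype.card (Idx P) : ℂ))⁻¹ • ∑ i : Idx P, covWalkSum V Z (walk (emb c.src) (stairWord i.2.1 (off i.1))))
          - ((avgFun (expMeanLogSU (n := n)) V c : Matrix.specialUnitaryGroup n ℂ) : Matrix n n ℂ)
              * (((Fintype.card (Idx P) : ℂ))⁻¹ • ∑ i : Idx P, covWalkSum V Z (walk (emb c.tgt) (stairWord i.2.1 (off i.1))))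
              * star ((avgFun (expMeanLogSU (n := n)) V c : Matrix.specialUnitaryGroup n ℂ) : Matrix n n ℂ))
      - ((Fintype.card (Idx P) : ℂ))⁻¹ • ∑ i : Idx P,
          ((holAt V (walk (emb c.src) (stairWord i.2.1 (off i.1))) : Matrix.specialUnitaryGroup n ℂ) : Matrix n n ℂ) *
            covWalkSum V Z (walk (walkEnd (emb c.src) (stairWord i.2.1 (off i.1))) (List.replicate P.L (c.dir, true))) *
          star ((holAt V (walk (emb c.src) (stairWord i.2.1 (off i.1))) : Matrix.specialUnitaryGroup n ℂ) : Matrix n n ℂ)‖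
      ≤ 159 * α * (((P.d + 2) * P.L : ℕ) : ℝ) * (2 * P.d * (P.L : ℝ) ^ P.d) * M := by
  classical
  refine (norm_defect_le_nbhd hj V Z c hα hα24 hN).trans ?_
  have hS : ∑ b ∈ univ.filter (fun b : PBond P j => blockOf b.src = c.src ∨ blockOf b.src = c.tgt), ‖Z b‖
      ≤ 2 * P.d * (P.L : ℝ) ^ P.d * M := by
    calc ∑ b ∈ univ.filter (fun b : PBond P j => blockOf b.src = c.src ∨ blockOf b.src = c.tgt), ‖Z b‖
        ≤ ∑ b ∈ univ.filter (fun b : PBond P j => blockOf b.src = c.src ∨ blockOf b.src = c.tgt), M := Finset.sum_le_sum fun b _ => hM b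
      _ = ((univ.filter fun b : PBond P j => blockOf b.src = c.src ∨ blockOf b.src = c.tgt).card : ℝ) * M := by
          rw [Finset.sum_const, nsmul_eq_mul]
      _ ≤ 2 * P.d * (P.L : ℝ) ^ P.d * M := mul_le_mul_of_nonneg_right (card_nbhd_le hj c) hM0
  calc 159 * α * ((((P.d + 2) * P.L : ℕ) : ℝ) * ∑ b ∈ univ.filter (fun b : PBond P j => blockOf b.src = c.src ∨ blockOf b.src = c.tgt), ‖Z b‖)
      ≤ 159 * α * ((((P.d + 2) * P.L : ℕ) : ℝ) * (2 * P.d * (P.L : ℝ) ^ P.d * M)) := by gcongr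
    _ = _ := by ring

/-! ## §2 ★★ The `k`-fold sup-norm rows of the reduced iterate -/

/-- ★★ **`G_k` IN SUP NORM, k-UNIFORMLY UP TO `L^k`, AND SUP-CLOSE TO THE PURE `LINE`-ITERATE.**  Tower `Ū₀^{(j)} = Averaging.iter (blockAvg ℰp) j U₀` in the standing range `k ≤ m + K`;
`G` the reduced recursion family at the covariant stair mean (`hG0`, `hGs` — DEFECT's letters VERBATIM), `S` the pure recursion `S 0 = Y`, `S (j+1) c = LINE_{Ū₀^{(j)}}(S j)(c)`
(`hS0`, `hSs`); per-level loop-variable sizes `dist1(W^{(j)}_i(c)) ≤ a j ≤ 1∕24`, `a j < δ_N`, `0 ≤ a j` (`j < k`); `‖Y b‖ ≤ M`.  Then with `κ_∞ = 159·(d+2)L·(2dL^d)`: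
`∀ c, L·‖G k c − S k c‖ ≤ L^k·κ_∞·(Σ_{j<k} a j)·exp((κ_∞∕L)Σ_{j<k} a j)·M` and `∀ c, ‖G k c‖ ≤ L^k·exp((κ_∞∕L)Σ_{j<k} a j)·M`.  Per level `B_{j+1} = (L + κ_∞a_j)B_j`,
`Δ_{j+1} = LΔ_j + κ_∞a_jB_j` (§1 + ✓`line_sub`), then ✓`recursion_bound` at `ρ := L`. [cite: Balaban1984PropagatorsI, (1.18)-(1.20) pp.19-20; Balaban1985Averaging, Prop. 3 (124)-(126) p.36] -/
theorem norm_reduced_sub_lineIter_le_of_sup (U₀ : GaugeField P 0 (Matrix.specialUnitaryGroup n ℂ)) (Y : PBond P 0 → Matrix n n ℂ)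
    (G S : (k : ℕ) → PBond P k → Matrix n n ℂ) (hG0 : ∀ b, G 0 b = Y b) (hS0 : ∀ b, S 0 b = Y b)
    (hGs : ∀ (k : ℕ) (c : PBond P (k + 1)), G (k + 1) c
      = (fderiv ℂ (eml : (Idx P → Matrix n n ℂ) → Matrix n n ℂ)
            (fun i => ((loopHol (Averaging.iter (fun i => blockAvg (P := P) (j := i) (expMeanLogSU (n := n))) k U₀) c i :
              Matrix.specialUnitaryGroup n ℂ) : Matrix n n ℂ))
            (fun i => covWalkSum (Averaging.iter (fun i => blockAvg (P := P) (j := i) (expMeanLogSU (n := n))) k U₀) (G k)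
                (walk (emb c.src) (loopWord P.L c.dir (off i.1) i.2.1 i.2.2))
              * ((loopHol (Averaging.iter (fun i => blockAvg (P := P) (j := i) (expMeanLogSU (n := n))) k U₀) c i :
                Matrix.specialUnitaryGroup n ℂ) : Matrix n n ℂ))
            * star ((corr (expMeanLogSU (n := n)) (Averaging.iter (fun i => blockAvg (P := P) (j := i) (expMeanLogSU (n := n))) k U₀) c :
                Matrix.specialUnitaryGroup n ℂ) : Matrix n n ℂ)
          + ((corr (expMeanLogSU (n := n)) (Averaging.iter (fun i => blockAvg (P := P) (j := i) (expMeanLogSU (n := n))) k U₀) c :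
                Matrix.specialUnitaryGroup n ℂ) : Matrix n n ℂ)
            * covWalkSum (Averaging.iter (fun i => blockAvg (P := P) (j := i) (expMeanLogSU (n := n))) k U₀) (G k)
                (walk (emb c.src) (List.replicate P.L (c.dir, true)))
            * star ((corr (expMeanLogSU (n := n)) (Averaging.iter (fun i => blockAvg (P := P) (j := i) (expMeanLogSU (n := n))) k U₀) c :
                Matrix.specialUnitaryGroup n ℂ) : Matrix n n ℂ))
        - ((((Fintype.card (Idx P) : ℂ))⁻¹ • ∑ i : Idx P,
              covWalkSum (Averaging.iter (fun i => blockAvg (P := P) (j := i) (expMeanLogSU (n := n))) k U₀) (G k) (walk (emb c.src) (stairWord i.2.1 (off i.1))))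
            - ((Averaging.iter (fun i => blockAvg (P := P) (j := i) (expMeanLogSU (n := n))) (k + 1) U₀ c : Matrix.specialUnitaryGroup n ℂ) :
                Matrix n n ℂ)
              * (((Fintype.card (Idx P) : ℂ))⁻¹ • ∑ i : Idx P,
                  covWalkSum (Averaging.iter (fun i => blockAvg (P := P) (j := i) (expMeanLogSU (n := n))) k U₀) (G k) (walk (emb c.tgt) (stairWord i.2.1 (off i.1))))
              * star ((Averaging.iter (fun i => blockAvg (P := P) (j := i) (expMeanLogSU (n := n))) (k + 1) U₀ c :
                Matrix.specialUnitaryGroup n ℂ) : Matrix n n ℂ)))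
    (hSs : ∀ (k : ℕ) (c : PBond P (k + 1)), S (k + 1) c
      = ((Fintype.card (Idx P) : ℂ))⁻¹ • ∑ i : Idx P,
          ((holAt (Averaging.iter (fun i => blockAvg (P := P) (j := i) (expMeanLogSU (n := n))) k U₀) (walk (emb c.src) (stairWord i.2.1 (off i.1))) :
              Matrix.specialUnitaryGroup n ℂ) : Matrix n n ℂ) *
            covWalkSum (Averaging.iter (fun i => blockAvg (P := P) (j := i) (expMeanLogSU (n := n))) k U₀) (S k)
              (walk (walkEnd (emb c.src) (stairWord i.2.1 (off i.1))) (List.replicate P.L (c.dir, true))) *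
          star ((holAt (Averaging.iter (fun i => blockAvg (P := P) (j := i) (expMeanLogSU (n := n))) k U₀) (walk (emb c.src) (stairWord i.2.1 (off i.1))) :
              Matrix.specialUnitaryGroup n ℂ) : Matrix n n ℂ))
    (a : ℕ → ℝ) (ha0 : ∀ j, 0 ≤ a j) {k : ℕ} (hk : k ≤ P.m + P.K)
    (hα : ∀ j < k, ∀ (c : PBond P (j + 1)) (i : Idx P),
        dist1 (loopHol (Averaging.iter (fun i => blockAvg (P := P) (j := i) (expMeanLogSU (n := n))) j U₀) c i) ≤ a j)
    (ha24 : ∀ j < k, a j ≤ 1 / 24) (haN : ∀ j < k, a j < deltaSU n) {M : ℝ} (hM0 : 0 ≤ M) (hM : ∀ b, ‖Y b‖ ≤ M) :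
    (∀ c : PBond P k, (P.L : ℝ) * ‖G k c - S k c‖
        ≤ (P.L : ℝ) ^ k * (159 * (((P.d + 2) * P.L : ℕ) : ℝ) * (2 * P.d * (P.L : ℝ) ^ P.d))
          * (∑ j ∈ Finset.range k, a j) * Real.exp ((159 * (((P.d + 2) * P.L : ℕ) : ℝ) * (2 * P.d * (P.L : ℝ) ^ P.d))
              / (P.L : ℝ) * ∑ j ∈ Finset.range k, a j) * M)
      ∧ ∀ c : PBond P k, ‖G k c‖
        ≤ (P.L : ℝ) ^ k * Real.exp ((159 * (((P.d + 2) * P.L : ℕ) : ℝ) * (2 * P.d * (P.L : ℝ) ^ P.d))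
              / (P.L : ℝ) * ∑ j ∈ Finset.range k, a j) * M := by
  have hLpos : (0 : ℝ) < (P.L : ℝ) := by exact_mod_cast P.L_pos
  -- letters
  set ρ : ℝ := (P.L : ℝ) with hρ
  set κ : ℝ := 159 * (((P.d + 2) * P.L : ℕ) : ℝ) * (2 * P.d * (P.L : ℝ) ^ P.d) with hκ
  have hρpos : 0 < ρ := hLpos
  have hκ0 : 0 ≤ κ := by positivity
  -- the bound sequences (by recursion) and their closed forms
  let g : ℕ → ℝ := fun j => Nat.rec (motive := fun _ => ℝ) M (fun j gj => (ρ + κ * a j) * gj) j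
  let δ : ℕ → ℝ := fun j => Nat.rec (motive := fun _ => ℝ × ℝ) (M, 0) (fun j p => ((ρ + κ * a j) * p.1, ρ * p.2 + κ * a j * p.1)) j |>.2
  have hg0 : g 0 = M := rfl
  have hgs : ∀ j, g (j + 1) = (ρ + κ * a j) * g j := fun j => rfl
  have hδ_fst : ∀ j, (Nat.rec (motive := fun _ => ℝ × ℝ) (M, 0) (fun j p => ((ρ + κ * a j) * p.1, ρ * p.2 + κ * a j * p.1)) j).1 = g j := by
    intro j
    induction j with
    | zero => rfl
    | succ j ih =>
      show (ρ + κ * a j) * (Nat.rec (motive := fun _ => ℝ × ℝ) (M, 0) (fun j p => ((ρ + κ * a j) * p.1, ρ * p.2 + κ * a j * p.1)) j).1 = (ρ + κ * a j) * g j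
      rw [ih]
  have hδ0 : δ 0 = 0 := rfl
  have hδs : ∀ j, δ (j + 1) = ρ * δ j + κ * a j * g j := by
    intro j
    show ρ * (Nat.rec (motive := fun _ => ℝ × ℝ) (M, 0) (fun j p => ((ρ + κ * a j) * p.1, ρ * p.2 + κ * a j * p.1)) j).2
        + κ * a j * (Nat.rec (motive := fun _ => ℝ × ℝ) (M, 0) (fun j p => ((ρ + κ * a j) * p.1, ρ * p.2 + κ * a j * p.1)) j).1 = ρ * δ j + κ * a j * g j
    rw [hδ_fst]
  have hg_nn : ∀ j, 0 ≤ g j := by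
    intro j
    induction j with
    | zero => exact hM0
    | succ j ih => rw [hgs]; have := ha0 j; positivity
  have hδ_nn : ∀ j, 0 ≤ δ j := by
    intro j
    induction j with
    | zero => exact le_of_eq hδ0.symm
    | succ j ih => rw [hδs]; have := ha0 j; have := hg_nn j; positivity
  -- the pointwise rows by induction on the level
  have hpt : ∀ j ≤ k, (∀ c, ‖G j c‖ ≤ g j) ∧ (∀ c, ‖G j c - S j c‖ ≤ δ j) := by
    intro j
    induction j with
    | zero =>
      intro _
      refine ⟨fun c => ?_, fun c => ?_⟩
      · rw [hG0, hg0]; exact hM c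
      · rw [hG0, hS0, sub_self, norm_zero, hδ0]
    | succ j ih =>
      intro hj
      have hj' : j < k := hj
      have hj1 : j + 1 ≤ P.m + P.K := by omega
      obtain ⟨ihg, ihδ⟩ := ih hj'.le
      set V := Averaging.iter (fun i => blockAvg (P := P) (j := i) (expMeanLogSU (n := n))) j U₀ with hV
      -- the three level-`j` fields as functions of the coarse bond: defect `D`, `LINE(G j)`, `LINE(G j − S j)`
      set D : PBond P (j + 1) → Matrix n n ℂ := fun c =>
        (fderiv ℂ (eml : (Idx P → Matrix n n ℂ) → Matrix n n ℂ) (fun i => ((loopHol V c i : Matrix.specialUnitaryGroup n ℂ) : Matrix n n ℂ))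
            (fun i => covWalkSum V (G j) (walk (emb c.src) (loopWord P.L c.dir (off i.1) i.2.1 i.2.2))
              * ((loopHol V c i : Matrix.specialUnitaryGroup n ℂ) : Matrix n n ℂ))
            * star ((corr (expMeanLogSU (n := n)) V c : Matrix.specialUnitaryGroup n ℂ) : Matrix n n ℂ)
          + ((corr (expMeanLogSU (n := n)) V c : Matrix.specialUnitaryGroup n ℂ) : Matrix n n ℂ)
            * covWalkSum V (G j) (walk (emb c.src) (List.replicate P.L (c.dir, true)))
            * star ((corr (expMeanLogSU (n := n)) V c : Matrix.specialUnitaryGroup n ℂ) : Matrix n n ℂ))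
        - ((((Fintype.card (Idx P) : ℂ))⁻¹ • ∑ i : Idx P, covWalkSum V (G j) (walk (emb c.src) (stairWord i.2.1 (off i.1))))
            - ((avgFun (expMeanLogSU (n := n)) V c : Matrix.specialUnitaryGroup n ℂ) : Matrix n n ℂ)
                * (((Fintype.card (Idx P) : ℂ))⁻¹ • ∑ i : Idx P, covWalkSum V (G j) (walk (emb c.tgt) (stairWord i.2.1 (off i.1))))
                * star ((avgFun (expMeanLogSU (n := n)) V c : Matrix.specialUnitaryGroup n ℂ) : Matrix n n ℂ))
        - ((Fintype.card (Idx P) : ℂ))⁻¹ • ∑ i : Idx P,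
            ((holAt V (walk (emb c.src) (stairWord i.2.1 (off i.1))) : Matrix.specialUnitaryGroup n ℂ) : Matrix n n ℂ) *
              covWalkSum V (G j) (walk (walkEnd (emb c.src) (stairWord i.2.1 (off i.1))) (List.replicate P.L (c.dir, true))) *
            star ((holAt V (walk (emb c.src) (stairWord i.2.1 (off i.1))) : Matrix.specialUnitaryGroup n ℂ) : Matrix n n ℂ) with hD
      set LG : PBond P (j + 1) → Matrix n n ℂ := fun c => ((Fintype.card (Idx P) : ℂ))⁻¹ • ∑ i : Idx P,
            ((holAt V (walk (emb c.src) (stairWord i.2.1 (off i.1))) : Matrix.specialUnitaryGroup n ℂ) : Matrix n n ℂ) *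
              covWalkSum V (G j) (walk (walkEnd (emb c.src) (stairWord i.2.1 (off i.1))) (List.replicate P.L (c.dir, true))) *
            star ((holAt V (walk (emb c.src) (stairWord i.2.1 (off i.1))) : Matrix.specialUnitaryGroup n ℂ) : Matrix n n ℂ) with hLG
      set LΔ : PBond P (j + 1) → Matrix n n ℂ := fun c => ((Fintype.card (Idx P) : ℂ))⁻¹ • ∑ i : Idx P,
            ((holAt V (walk (emb c.src) (stairWord i.2.1 (off i.1))) : Matrix.specialUnitaryGroup n ℂ) : Matrix n n ℂ) *
              covWalkSum V (G j - S j) (walk (walkEnd (emb c.src) (stairWord i.2.1 (off i.1))) (List.replicate P.L (c.dir, true))) *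
            star ((holAt V (walk (emb c.src) (stairWord i.2.1 (off i.1))) : Matrix.specialUnitaryGroup n ℂ) : Matrix n n ℂ) with hLΔ
      have hiter : Averaging.iter (fun i => blockAvg (P := P) (j := i) (expMeanLogSU (n := n))) (j + 1) U₀ = avgFun (expMeanLogSU (n := n)) V := rfl
      have hdecG : ∀ c, G (j + 1) c = D c + LG c := by
        intro c
        rw [hGs, hiter]
        simp only [hD, hLG]
        abel
      have hdecΔ : ∀ c, G (j + 1) c - S (j + 1) c = D c + LΔ c := by
        intro c
        rw [hdecG, hSs, hLΔ, hLG, hD]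
        simp only [line_sub V (G j) (S j) c]
        abel
      -- the sup rows of the pieces
      have hDrow : ∀ c, ‖D c‖ ≤ κ * a j * g j := by
        intro c
        have h := norm_defect_le_of_sup hj1 V (G j) (hg_nn j) ihg c (ha0 j) (hα j hj' c) (ha24 j hj') (haN j hj')
        have h' : ‖D c‖ ≤ 159 * a j * (((P.d + 2) * P.L : ℕ) : ℝ) * (2 * P.d * (P.L : ℝ) ^ P.d) * g j := by simpa only [hD] using h
        calc ‖D c‖ ≤ 159 * a j * (((P.d + 2) * P.L : ℕ) : ℝ) * (2 * P.d * (P.L : ℝ) ^ P.d) * g j := h'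
          _ = κ * a j * g j := by rw [hκ]; ring
      have hLGrow : ∀ c, ‖LG c‖ ≤ ρ * g j := by
        intro c
        have h := norm_line_le_of_sup V (G j) ihg c
        simpa only [hLG, hρ] using h
      have hLΔrow : ∀ c, ‖LΔ c‖ ≤ ρ * δ j := by
        intro c
        have h := norm_line_le_of_sup V (G j - S j) (fun b => by simpa only [Pi.sub_apply] using ihδ b) c
        simpa only [hLΔ, hρ] using h
      refine ⟨fun c => ?_, fun c => ?_⟩
      · calc ‖G (j + 1) c‖ = ‖D c + LG c‖ := by rw [hdecG]
          _ ≤ ‖D c‖ + ‖LG c‖ := norm_add_le _ _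
          _ ≤ κ * a j * g j + ρ * g j := add_le_add (hDrow c) (hLGrow c)
          _ = g (j + 1) := by rw [hgs]; ring
      · calc ‖G (j + 1) c - S (j + 1) c‖ = ‖D c + LΔ c‖ := by rw [hdecΔ]
          _ ≤ ‖D c‖ + ‖LΔ c‖ := norm_add_le _ _
          _ ≤ κ * a j * g j + ρ * δ j := add_le_add (hDrow c) (hLΔrow c)
          _ = δ (j + 1) := by rw [hδs]; ring
  -- the recursion bound on the bound sequences
  have hmain := recursion_bound hρpos hκ0 a g δ ha0 hg_nn hδ0 k (fun j _ => (hgs j).le) (fun j _ => (hδs j).le)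
  rw [hg0] at hmain
  obtain ⟨hgk, hδk⟩ := hpt k le_rfl
  refine ⟨fun c => ?_, fun c => (hgk c).trans hmain.1⟩
  calc (P.L : ℝ) * ‖G k c - S k c‖ ≤ ρ * δ k := mul_le_mul_of_nonneg_left (hδk c) hLpos.le
    _ ≤ _ := hmain.2

end Summit.QuantumFields.YangMills.Theorems.Prop7TrueLinIterRow

end
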